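import Literature.Probability.LatticeModels.ProdBernoulliBK
import Literature.Probability.LatticeModels.ProdBernoulliIndependence
import HarnessLib

/-!
# `NoHeavyLowerTail` (crux stmt-CriticalPhenomena-4575), abstract sunflower cubic: the BOX ENCODING of a sunflower whose core has (at
# most) two minimal elements, and the law of the box event under a product measure

Support file (seat `prim-ineq-prove-1` gen 34; `--supports stmt-CriticalPhenomena-4575`).  No `sorry`, no named facts.  Memo:
run/shared/lean/prim/prim-ineq-prove-1/FINDING-PRINCIPALCORE-prove1-g34.md §3 (the case `r ≤ 2` of the Δ-system reduction).
Sequel: `…SunflowerTwoGeneratorCore` (the theorem `∏_i μ(V_i) ≤ μ(A)^{K−1}` for cores `A = {g₁ ⊆ ω} ∪ {g₂ ⊆ ω}`).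

SETTING.  `ι` finite, `μ = prodBernoulli p`; two finite sets of coordinates `g₁, g₂` (the minimal elements of the core; `g₁ = g₂` is the
principal case), kernel `h = g₁ ∩ g₂`, private parts `a = g₁ ∖ g₂`, `b = g₂ ∖ g₁`; `core g₁ g₂ = {ω | g₁ ⊆ ω} ∪ {ω | g₂ ⊆ ω}`.
BOX ENCODING (memo §3 (a)–(d)).  A configuration `ω` misses the set `h ∖ ω` of kernel coordinates and the RECTANGLE `(a ∖ ω) × (b ∖ ω)`;
`ω ∈ core` iff both are empty; `ω ∪ ω' ∈ core` forces the missing data of `ω` and `ω'` to be DISJOINT.  Hence for an up-set `V`, the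
SUPPORTS `suppH V ⊆ h`, `suppB V ⊆ a × b` (everything missed by some `ω ∈ V ∖ core`) satisfy `V ⊆ Zset (suppH V) (suppB V)`
(`subset_Zset`), where `Zset Uh Ub = {ω | h∖ω ⊆ Uh, (a∖ω)×(b∖ω) ⊆ Ub}`, and two up-sets whose intersection lies in the core have
DISJOINT supports (`disjoint_suppH`, `disjoint_suppB`).
LAW OF THE BOX EVENT (memo §3 (e)): `real_Zset` —
  `μ(Zset Uh Ub) = (∏_{e ∈ h∖Uh} p e) · Σ_{T ⊆ a} (∏_{e∈T}(1 − p e))(∏_{e∈a∖T} p e) · ∏_{f ∈ b ∖ col Ub T} p f`,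
`col Ub T = {f ∈ b | T × {f} ⊆ Ub}` (condition on the missing part `T` of `a`; independence of the blocks `h`, `a`, `b`; cylinder
probabilities).
-/

noncomputable section

namespace Summit.CriticalPhenomena.PercolationContinuityZ3.Theorems.SunflowerPartition

namespace TwoGenCore

open MeasureTheory Finset
open Literature.Probability.LatticeModels Literature.Probability.Percolation

variable {ι : Type*} [DecidableEq ι]

/-! ## The core and the box event -/

/-- The core with minimal elements `g₁, g₂`: `{ω | g₁ ⊆ ω} ∪ {ω | g₂ ⊆ ω}`. [this work] -/
def core (g₁ g₂ : Finset ι) : Set (Set ι) := {ω | (g₁ : Set ι) ⊆ ω} ∪ {ω | (g₂ : Set ι) ⊆ ω}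

/-- The box event: the kernel coordinates missed by `ω` lie in `Uh` and the rectangle of missed private coordinates lies in `Ub`. [this work] -/
def Zset (g₁ g₂ : Finset ι) (Uh : Finset ι) (Ub : Finset (ι × ι)) : Set (Set ι) :=
  {ω | (∀ e ∈ g₁ ∩ g₂, e ∉ ω → e ∈ Uh) ∧ (∀ e ∈ g₁ \ g₂, ∀ f ∈ g₂ \ g₁, e ∉ ω → f ∉ ω → (e, f) ∈ Ub)}

open scoped Classical in
/-- Kernel support of an event: kernel coordinates missed by some non-core member. [this work] -/
def suppH (g₁ g₂ : Finset ι) (V : Set (Set ι)) : Finset ι :=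
  (g₁ ∩ g₂).filter fun e => ∃ ω ∈ V, ω ∉ core g₁ g₂ ∧ e ∉ ω

open scoped Classical in
/-- Box support of an event: pairs of private coordinates missed by some non-core member. [this work] -/
def suppB (g₁ g₂ : Finset ι) (V : Set (Set ι)) : Finset (ι × ι) :=
  ((g₁ \ g₂) ×ˢ (g₂ \ g₁)).filter fun ef => ∃ ω ∈ V, ω ∉ core g₁ g₂ ∧ ef.1 ∉ ω ∧ ef.2 ∉ ω

omit [DecidableEq ι] in
/-- Membership in the core. [this work] -/
theorem mem_core {g₁ g₂ : Finset ι} {ω : Set ι} : ω ∈ core g₁ g₂ ↔ (g₁ : Set ι) ⊆ ω ∨ (g₂ : Set ι) ⊆ ω := Iff.rfl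

/-- **Every event lies in the box event of its supports** (memo §3 (a),(d)). [this work] -/
theorem subset_Zset (g₁ g₂ : Finset ι) (V : Set (Set ι)) : V ⊆ Zset g₁ g₂ (suppH g₁ g₂ V) (suppB g₁ g₂ V) := by
  classical
  intro ω hω
  by_cases hc : ω ∈ core g₁ g₂
  · -- a core configuration misses nothing relevant
    refine ⟨fun e he heω => ?_, fun e he f hf heω hfω => ?_⟩
    · exfalso
      rw [Finset.mem_inter] at he
      rcases mem_core.1 hc with h | h
      · exact heω (h (Finset.mem_coe.2 he.1))
      · exact heω (h (Finset.mem_coe.2 he.2))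
    · exfalso
      rw [Finset.mem_sdiff] at he hf
      rcases mem_core.1 hc with h | h
      · exact heω (h (Finset.mem_coe.2 he.1))
      · exact hfω (h (Finset.mem_coe.2 hf.1))
  · refine ⟨fun e he heω => ?_, fun e he f hf heω hfω => ?_⟩
    · exact Finset.mem_filter.2 ⟨he, ω, hω, hc, heω⟩
    · exact Finset.mem_filter.2 ⟨Finset.mem_product.2 ⟨he, hf⟩, ω, hω, hc, heω, hfω⟩

/-- **Disjoint kernel supports** for up-sets meeting inside the core (memo §3 (b)). [this work] -/
theorem disjoint_suppH {g₁ g₂ : Finset ι} {V W : Set (Set ι)} (hV : IsUpperSet V) (hW : IsUpperSet W)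
    (hVW : V ∩ W ⊆ core g₁ g₂) : Disjoint (suppH g₁ g₂ V) (suppH g₁ g₂ W) := by
  classical
  rw [Finset.disjoint_left]
  intro e heV heW
  obtain ⟨he, ω, hω, -, heω⟩ := Finset.mem_filter.1 heV
  obtain ⟨-, ω', hω', -, heω'⟩ := Finset.mem_filter.1 heW
  have hu : ω ∪ ω' ∈ core g₁ g₂ := hVW ⟨hV Set.subset_union_left hω, hW Set.subset_union_right hω'⟩
  rw [Finset.mem_inter] at he
  have : e ∉ ω ∪ ω' := fun h => h.elim heω heω'
  rcases mem_core.1 hu with h | h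
  · exact this (h (Finset.mem_coe.2 he.1))
  · exact this (h (Finset.mem_coe.2 he.2))

/-- **Disjoint box supports** for up-sets meeting inside the core (memo §3 (b): rectangles of different petals are disjoint). [this work] -/
theorem disjoint_suppB {g₁ g₂ : Finset ι} {V W : Set (Set ι)} (hV : IsUpperSet V) (hW : IsUpperSet W)
    (hVW : V ∩ W ⊆ core g₁ g₂) : Disjoint (suppB g₁ g₂ V) (suppB g₁ g₂ W) := by
  classical
  rw [Finset.disjoint_left]
  rintro ⟨e, f⟩ heV heW
  obtain ⟨hef, ω, hω, -, heω, hfω⟩ := Finset.mem_filter.1 heV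
  obtain ⟨-, ω', hω', -, heω', hfω'⟩ := Finset.mem_filter.1 heW
  have hu : ω ∪ ω' ∈ core g₁ g₂ := hVW ⟨hV Set.subset_union_left hω, hW Set.subset_union_right hω'⟩
  obtain ⟨he, hf⟩ := Finset.mem_product.1 hef
  rw [Finset.mem_sdiff] at he hf
  rcases mem_core.1 hu with h | h
  · exact (h (Finset.mem_coe.2 he.1)).elim heω heω'
  · exact (h (Finset.mem_coe.2 hf.1)).elim hfω hfω'

/-! ## The law of the box event -/

/-- Columns of `Ub` over a set `T` of rows: `col g₁ g₂ Ub T = {f ∈ b | ∀ e ∈ T, (e,f) ∈ Ub}`. [this work] -/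
def col (g₁ g₂ : Finset ι) (Ub : Finset (ι × ι)) (T : Finset ι) : Finset ι :=
  (g₂ \ g₁).filter fun f => ∀ e ∈ T, (e, f) ∈ Ub

omit [DecidableEq ι] in
/-- Membership in `col`. [this work] -/
theorem mem_col [DecidableEq ι] {g₁ g₂ : Finset ι} {Ub : Finset (ι × ι)} {T : Finset ι} {f : ι} :
    f ∈ col g₁ g₂ Ub T ↔ f ∈ g₂ \ g₁ ∧ ∀ e ∈ T, (e, f) ∈ Ub := by
  unfold col; rw [Finset.mem_filter]

/-- The Bernoulli weight of "exactly `T` is missing from `a`". [this work] -/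
def wmiss (p : ι → unitInterval) (a T : Finset ι) : ℝ := (∏ e ∈ T, (1 - (p e : ℝ))) * ∏ e ∈ a \ T, (p e : ℝ)

section Law

variable (p : ι → unitInterval) (g₁ g₂ : Finset ι)

/-- The kernel part of the box event is a principal filter. [this work] -/
theorem setOf_kernel_eq (Uh : Finset ι) :
    {ω : Set ι | ∀ e ∈ g₁ ∩ g₂, e ∉ ω → e ∈ Uh} = {ω | (((g₁ ∩ g₂) \ Uh : Finset ι) : Set ι) ⊆ ω} := by
  ext ω
  simp only [Set.mem_setOf_eq, Finset.coe_sdiff, Set.sdiff_subset_iff]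
  constructor
  · intro h e he
    by_cases heω : e ∈ ω
    · exact Or.inr heω
    · exact Or.inl (h e he heω)
  · intro h e he heω
    rcases h (Finset.mem_coe.2 he) with h' | h'
    · exact h'
    · exact absurd h' heω

/-- The cylinder "the missing part of `a` is exactly `T`". [this work] -/
def cyl (a T : Finset ι) : Set (Set ι) := {ω | ∀ e ∈ a, e ∈ ω ↔ e ∉ T}

/-- Every configuration lies in exactly one cylinder: the one of its missing part. [this work] -/
theorem mem_cyl_iff {a T : Finset ι} (hT : T ⊆ a) {ω : Set ι} [DecidablePred (· ∈ ω)] :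
    ω ∈ cyl a T ↔ a.filter (· ∉ ω) = T := by
  constructor
  · intro h
    ext e
    rw [Finset.mem_filter]
    constructor
    · rintro ⟨he, heω⟩
      by_contra heT
      exact heω ((h e he).2 heT)
    · intro heT
      exact ⟨hT heT, fun heω => (h e (hT heT)).1 heω heT⟩
  · intro h e he
    rw [← h, Finset.mem_filter]
    constructor
    · intro heω ⟨_, h'⟩; exact h' heω
    · intro hne; by_contra heω; exact hne ⟨he, heω⟩

/-- Probability of a cylinder. [this work] -/
theorem real_cyl {a T : Finset ι} (hT : T ⊆ a) : (prodBernoulli p).real (cyl a T) = wmiss p a T := by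
  have h := prodBernoulli_real_cylinder_pattern p a (fun e => decide ((e : ι) ∉ T))
  have hset : {ω : Set ι | ∀ (i) (h : i ∈ a), i ∈ ω ↔ (fun e : a => decide ((e : ι) ∉ T)) ⟨i, h⟩ = true} = cyl a T := by
    ext ω; simp [cyl]
  rw [hset] at h
  rw [h, wmiss]
  -- split the product over `a` according to membership in `T`
  rw [show (∏ i : a, if (decide ((i : ι) ∉ T)) = true then ((p i : unitInterval) : ℝ) else 1 - ((p i : unitInterval) : ℝ)) =
      ∏ i ∈ a, (if i ∉ T then (p i : ℝ) else 1 - (p i : ℝ)) from by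
    rw [← Finset.prod_coe_sort a]; simp]
  rw [Finset.prod_ite, mul_comm]
  congr 1
  · congr 1; ext e; simp only [Finset.mem_filter, not_not]
    exact ⟨fun h => h.2, fun h => ⟨hT h, h⟩⟩
  · congr 1; ext e; simp [Finset.mem_sdiff]

/-- Decomposition of the box part of `Zset` into cylinders. [this work] -/
theorem setOf_box_eq (Ub : Finset (ι × ι)) :
    {ω : Set ι | ∀ e ∈ g₁ \ g₂, ∀ f ∈ g₂ \ g₁, e ∉ ω → f ∉ ω → (e, f) ∈ Ub} =
      ⋃ T ∈ (g₁ \ g₂).powerset, (cyl (g₁ \ g₂) T ∩ {ω | (((g₂ \ g₁) \ col g₁ g₂ Ub T : Finset ι) : Set ι) ⊆ ω}) := by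
  classical
  ext ω
  simp only [Set.mem_setOf_eq, Set.mem_iUnion, Set.mem_inter_iff, exists_prop]
  constructor
  · intro h
    refine ⟨(g₁ \ g₂).filter (· ∉ ω), Finset.mem_powerset.2 (Finset.filter_subset _ _),
      (mem_cyl_iff (Finset.filter_subset _ _)).2 rfl, ?_⟩
    intro f hf
    rw [Finset.coe_sdiff, Set.mem_sdiff, Finset.mem_coe, Finset.mem_coe] at hf
    by_contra hfω
    apply hf.2
    unfold col
    rw [Finset.mem_filter]
    refine ⟨hf.1, fun e he => ?_⟩
    rw [Finset.mem_filter] at he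
    exact h e he.1 f hf.1 he.2 hfω
  · rintro ⟨T, hT, hcyl, hsub⟩ e he f hf heω hfω
    rw [Finset.mem_powerset] at hT
    have hTeq := (mem_cyl_iff hT).1 hcyl
    have heT : e ∈ T := by rw [← hTeq, Finset.mem_filter]; exact ⟨he, heω⟩
    by_contra hef
    have : f ∈ (((g₂ \ g₁) \ col g₁ g₂ Ub T : Finset ι) : Set ι) := by
      rw [Finset.mem_coe, Finset.mem_sdiff]
      refine ⟨hf, fun h => hef ?_⟩
      unfold col at h
      exact (Finset.mem_filter.1 h).2 e heT
    exact hfω (hsub this)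

omit [DecidableEq ι] in
/-- `DeterminedBy` for the events used here, via the set-theoretic criterion. [this work] -/
theorem determinedBy_of_mem {C : Set (Set ι)} {F : Finset ι} (h : ∀ ω ω' : Set ι, (∀ e ∈ F, e ∈ ω ↔ e ∈ ω') → ω ∈ C → ω' ∈ C) :
    DeterminedBy C (↑F : Set ι) := by
  rw [determinedBy_iff]
  intro ω ω' hωω'
  have key : ∀ e ∈ F, e ∈ ω ↔ e ∈ ω' := fun e he =>
    ⟨fun heω => ((Set.ext_iff.1 hωω' e).1 ⟨heω, Finset.mem_coe.2 he⟩).1,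
     fun heω' => ((Set.ext_iff.1 hωω' e).2 ⟨heω', Finset.mem_coe.2 he⟩).1⟩
  exact ⟨h ω ω' key, h ω' ω fun e he => (key e he).symm⟩

/-- **Law of the box event** (memo §3 (e)). [this work] -/
theorem real_Zset [Fintype ι] (Uh : Finset ι) (Ub : Finset (ι × ι)) :
    (prodBernoulli p).real (Zset g₁ g₂ Uh Ub) =
      (∏ e ∈ (g₁ ∩ g₂) \ Uh, (p e : ℝ)) *
        ∑ T ∈ (g₁ \ g₂).powerset, wmiss p (g₁ \ g₂) T * ∏ f ∈ (g₂ \ g₁) \ col g₁ g₂ Ub T, (p f : ℝ) := by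
  classical
  set h := g₁ ∩ g₂ with hh
  set a := g₁ \ g₂ with ha
  set b := g₂ \ g₁ with hb
  -- `Zset = kernel event ∩ box event`, independent (blocks `h` and `a ∪ b`)
  have hZ : Zset g₁ g₂ Uh Ub = {ω : Set ι | ∀ e ∈ g₁ ∩ g₂, e ∉ ω → e ∈ Uh} ∩
      {ω | ∀ e ∈ g₁ \ g₂, ∀ f ∈ g₂ \ g₁, e ∉ ω → f ∉ ω → (e, f) ∈ Ub} := rfl
  have hdetK : DeterminedBy {ω : Set ι | ∀ e ∈ g₁ ∩ g₂, e ∉ ω → e ∈ Uh} (↑h : Set ι) :=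
    determinedBy_of_mem fun ω ω' hag hω e he heω' => hω e he fun heω => heω' ((hag e he).1 heω)
  have hdetB : DeterminedBy {ω : Set ι | ∀ e ∈ g₁ \ g₂, ∀ f ∈ g₂ \ g₁, e ∉ ω → f ∉ ω → (e, f) ∈ Ub} (↑(a ∪ b) : Set ι) :=
    determinedBy_of_mem fun ω ω' hag hω e he f hf heω' hfω' =>
      hω e he f hf (fun heω => heω' ((hag e (Finset.mem_union_left _ he)).1 heω))
        (fun hfω => hfω' ((hag f (Finset.mem_union_right _ hf)).1 hfω))
  have hdisj : Disjoint h (a ∪ b) := by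
    rw [Finset.disjoint_left]
    intro e he heab
    rw [hh, Finset.mem_inter] at he
    rcases Finset.mem_union.1 heab with h' | h'
    · exact (Finset.mem_sdiff.1 h').2 he.2
    · exact (Finset.mem_sdiff.1 h').2 he.1
  rw [hZ, prodBernoulli_real_inter_of_determinedBy_disjoint p hdisj hdetK hdetB MeasurableSet.of_discrete
    MeasurableSet.of_discrete, setOf_kernel_eq, prodBernoulli_real_subset, setOf_box_eq]
  congr 1
  -- the box event as a disjoint union of cylinders
  rw [measureReal_biUnion_finset]
  · refine Finset.sum_congr rfl fun T hT => ?_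
    rw [Finset.mem_powerset] at hT
    have hdetC : DeterminedBy (cyl (g₁ \ g₂) T) (↑a : Set ι) :=
      determinedBy_of_mem fun ω ω' hag hω e he => (hag e he).symm.trans (hω e he)
    have hdetD : DeterminedBy {ω : Set ι | (((g₂ \ g₁) \ col g₁ g₂ Ub T : Finset ι) : Set ι) ⊆ ω} (↑b : Set ι) :=
      determinedBy_of_mem fun ω ω' hag hω f hf => by
        have hf' : f ∈ b := (Finset.mem_sdiff.1 (Finset.mem_coe.1 hf)).1
        exact (hag f hf').1 (hω hf)
    have hab : Disjoint a b := by
      rw [Finset.disjoint_left]; intro e he heb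
      exact (Finset.mem_sdiff.1 heb).2 (Finset.mem_sdiff.1 he).1
    rw [prodBernoulli_real_inter_of_determinedBy_disjoint p hab hdetC hdetD MeasurableSet.of_discrete
      MeasurableSet.of_discrete, real_cyl p hT, prodBernoulli_real_subset]
  · intro T hT T' hT' hne
    rw [Function.onFun, Set.disjoint_left]
    rintro ω ⟨hω, -⟩ ⟨hω', -⟩
    rw [Finset.mem_coe, Finset.mem_powerset] at hT hT'
    exact hne (((mem_cyl_iff hT).1 hω).symm.trans ((mem_cyl_iff hT').1 hω'))
  · intro T _; exact MeasurableSet.of_discrete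

end Law

end TwoGenCore

end Summit.CriticalPhenomena.PercolationContinuityZ3.Theorems.SunflowerPartition
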